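import Mathlib
import HarnessLib
import Summits.CriticalPhenomena.CardyFormulaZ2.Theses.CardySelfRefinement
import Literature.Probability.Percolation.QuadCrossingSpaceZ2
import Literature.Probability.Percolation.Crossings

/-!
# Sketch (crux-ideate, ideator 3): first lemmas for the two idea cards on the crux
`ScaleInvariantLimits` (stmt-CriticalPhenomena-10265).

* Card `marginal-three-arm-bootstrap`: `NearIdentityGain` (C⁺), `DilationContinuityAtOne`,
  `CrossingMarginalsDetermine`, and the FIRST LEMMA `NearIdentityBootstrap`
  (C⁺ + two Schramm–Smirnov-type facts ⇒ the crux).  Also the orbit-level (lattice) form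
  `LatticeNearIdentityGain` and `LatticeBootstrap`.
* Card `razumov-stroganov-boundary-sector`: `DiagonalBoundaryAnisotropyIndependence`
  (Yang–Baxter signature, first checkable statement) and the sector target
  `HalfPlaneCollinearCrossingLimit`.

Nothing here is proved; every declaration is a `Prop` that elaborates over tree declarations.
-/

namespace Summit.CriticalPhenomena.CardyFormulaZ2.Cruxes.ScaleInvariantLimits.SketchIdeator3

open MeasureTheory Filter Set
open Literature.Probability.Percolation
open Literature.Probability.Percolation.QuadCrossing
open Literature.Probability.LatticeModels

noncomputable section

/-! ## Card A — marginal three-arm bootstrap -/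

/-- The joint crossing event of a finite family of quads of the plane. -/
def crossAll {m : ℕ} (F : Fin m → Quad (univ : Set ℂ)) : Set (QuadConfig (univ : Set ℂ)) :=
  {S | ∀ i, F i ∈ S}

/-- **C⁺ = near-identity gain.** For every `ε > 0` there is a lag `1 + τ`, `0 < τ < ε`, such that
EVERY subsequential limit `μ` and EVERY finite-dimensional crossing marginal move by at most
`ε·τ` under the dilation `S_{1+τ}`.  The trivial bound (boundary three-arm count, exponent `2`,
known on `ℤ²`) gives `C·τ`; the content of C⁺ is the little-o. -/
def NearIdentityGain : Prop :=
  ∀ ε : ℝ, 0 < ε → ∃ τ : ℝ, ∃ hτ : 0 < τ, τ < ε ∧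
    ∀ μ ∈ subseqQuadLimits (univ : Set ℂ), ∀ (m : ℕ) (F : Fin m → Quad (univ : Set ℂ)),
      |(μ : Measure (QuadConfig (univ : Set ℂ))).real (crossAll F) -
        ((dilateLaw (1 + τ) (add_pos one_pos hτ).ne' μ :
            FiniteMeasure (QuadConfig (univ : Set ℂ))) :
          Measure (QuadConfig (univ : Set ℂ))).real (crossAll F)| ≤ ε * τ

/-- Continuity of finite-dimensional crossing marginals of sublimits under dilations near the
identity (an RSW / boundary-three-arm fact of Schramm–Smirnov type; used to pass from lags
`(1+τ)^m` to the lag `2`). -/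
def DilationContinuityAtOne : Prop :=
  ∀ μ ∈ subseqQuadLimits (univ : Set ℂ), ∀ (m : ℕ) (F : Fin m → Quad (univ : Set ℂ)),
    Tendsto (fun s : ℝ => ((dilateLaw (Real.exp s) (Real.exp_pos s).ne' μ :
        FiniteMeasure (QuadConfig (univ : Set ℂ))) :
        Measure (QuadConfig (univ : Set ℂ))).real (crossAll F))
      (nhds 0) (nhds ((μ : Measure (QuadConfig (univ : Set ℂ))).real (crossAll F)))

/-- Finite-dimensional crossing marginals determine a sublimit (Schramm–Smirnov Thm 1.4 (2):
crossing events of finitely many quads form a π-system generating the Borel σ-field; sublimits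
are probability measures). -/
def CrossingMarginalsDetermine : Prop :=
  ∀ μ ∈ subseqQuadLimits (univ : Set ℂ), ∀ ν ∈ subseqQuadLimits (univ : Set ℂ),
    (∀ (m : ℕ) (F : Fin m → Quad (univ : Set ℂ)),
      (μ : Measure (QuadConfig (univ : Set ℂ))).real (crossAll F) =
        (ν : Measure (QuadConfig (univ : Set ℂ))).real (crossAll F)) → μ = ν

/-- **FIRST LEMMA (Card A).** Near-identity gain bootstraps to every lag: compose
`m ≈ (log 2)/τ` near-identity steps inside the dilation-invariant set of sublimits
(error `≤ m·ε·τ ≤ ε log 2`), finish with `DilationContinuityAtOne`, conclude `S_2 μ = μ`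
(and every `S_t`) by `CrossingMarginalsDetermine`; the closed-subgroup argument of the
route's `TwoLagsAllLags` is not even needed since every `t` is reached directly. -/
def NearIdentityBootstrap : Prop :=
  NearIdentityGain → DilationContinuityAtOne → CrossingMarginalsDetermine →
    Summit.CriticalPhenomena.CardyFormulaZ2.Theses.CardySelfRefinement.ScaleInvariantLimits

/-- The same gain stated on the LATTICE ORBIT (no limit objects): for every `ε > 0` some lag
`1 + τ`, `0 < τ < ε`, moves the joint crossing probabilities of bond-`ℤ²` at mesh `δ` by at
most `ε τ` for all small `δ`, for every finite family of quads.  Here `μ_δ = z2QuadLaw univ δ`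
and `dilateLaw (1+τ) μ_δ = μ_{(1+τ)δ}` exactly (`dilateLaw_z2QuadLaw`). -/
def LatticeNearIdentityGain : Prop :=
  ∀ ε : ℝ, 0 < ε → ∃ τ : ℝ, 0 < τ ∧ τ < ε ∧
    ∀ (m : ℕ) (F : Fin m → Quad (univ : Set ℂ)), ∃ δ₀ : ℝ, 0 < δ₀ ∧ ∀ δ ∈ Ioo (0 : ℝ) δ₀,
      |(z2QuadLaw (univ : Set ℂ) δ : Measure (QuadConfig (univ : Set ℂ))).real (crossAll F) -
        (z2QuadLaw (univ : Set ℂ) ((1 + τ) * δ) :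
          Measure (QuadConfig (univ : Set ℂ))).real (crossAll F)| ≤ ε * τ

/-- Lattice form of the bootstrap (needs in addition that joint crossing events are continuity
sets of every sublimit, the same Schramm–Smirnov §5 fact the route's `LagsToInvariance` uses). -/
def LatticeBootstrap : Prop :=
  LatticeNearIdentityGain → DilationContinuityAtOne → CrossingMarginalsDetermine →
    (∀ μ ∈ subseqQuadLimits (univ : Set ℂ), ∀ (m : ℕ) (F : Fin m → Quad (univ : Set ℂ)),
      (μ : Measure (QuadConfig (univ : Set ℂ))) (frontier (crossAll F)) = 0) →
    Summit.CriticalPhenomena.CardyFormulaZ2.Theses.CardySelfRefinement.ScaleInvariantLimits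

/-! ## Card B — Razumov–Stroganov boundary sector -/

open Classical in
/-- Kesten's anisotropic critical bond percolation on `ℤ²`: horizontal edges open with
probability `p`, vertical edges with probability `1 - p`, non-edges closed. -/
def anisoLaw (p : unitInterval) : Measure (BondConfig (Site 2)) :=
  prodBernoulli fun e : Sym2 (Site 2) =>
    if e ∈ (zdGraph 2).edgeSet then
      (if ∃ v : Site 2, e = s(v, v + ![1, 0]) then p else unitInterval.symm p)
    else 0

/-- The closed diagonal half-plane `{x₀ + x₁ ≤ 0}` (a half-plane bounded by a TRACK line of the
isoradial square lattice) and its boundary row. -/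
def diagHalfPlane : Set (Site 2) := {x | x 0 + x 1 ≤ 0}

/-- Boundary arc `{(i, -i) : a ≤ i ≤ b}` of the diagonal half-plane. -/
def diagArc (a b : ℤ) : Set (Site 2) := {x | x 0 + x 1 = 0 ∧ a ≤ x 0 ∧ x 0 ≤ b}

/-- **FIRST CHECKABLE STATEMENT (Card B): anisotropy-independence of the diagonal boundary
law.** The probability that two boundary arcs of the diagonal half-plane are joined by an open
path of the half-plane does not depend on the anisotropy `p ∈ (0,1)` along Kesten's critical
line `p_h + p_v = 1` (Yang–Baxter: the diagonal-to-diagonal transfer matrices of the `n = 1`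
Temperley–Lieb loop model commute, so the stationary boundary law is the common
Razumov–Stroganov Perron vector; verified by exact rational computation on the half-cylinders
of perimeter `N ≤ 5` in this seat's `scratch/halfcyl.py`). -/
def DiagonalBoundaryAnisotropyIndependence : Prop :=
  ∀ p q : unitInterval, 0 < (p : ℝ) → (p : ℝ) < 1 → 0 < (q : ℝ) → (q : ℝ) < 1 →
    ∀ a b c d : ℤ,
      (anisoLaw p).real (openCrossing diagHalfPlane (diagArc a b) (diagArc c d)) =
        (anisoLaw q).real (openCrossing diagHalfPlane (diagArc a b) (diagArc c d))

/-- **Sector target (Card B): the collinear-mark half-plane crossing probabilities converge.**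
For rational marks `0 ≤ a < b < c < d`, the `P_{1/2}` probability that the boundary arcs
`[ak, bk]` and `[ck, dk]` of the diagonal half-plane are joined inside it converges as
`k → ∞` (LimitExists in the Razumov–Stroganov sector; its consequence for the crux is lag
invariance of every sublimit on the σ-algebra of half-plane boundary events). -/
def HalfPlaneCollinearCrossingLimit : Prop :=
  ∀ a b c d : ℕ, a < b → b < c → c < d → ∃ L : ℝ,
    Tendsto (fun k : ℕ =>
      (bondPercolation (zdGraph 2) half).real
        (openCrossing diagHalfPlane (diagArc (a * k) (b * k)) (diagArc (c * k) (d * k))))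
      atTop (nhds L)

end

end Summit.CriticalPhenomena.CardyFormulaZ2.Cruxes.ScaleInvariantLimits.SketchIdeator3
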